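import Literature.NumberTheory.Sieve.MatomakiRadziwillLemma12
import HarnessLib

/-!
# Matomäki–Radziwiłł 2016, Proposition 1 — part (a): the partition `[T₀, T] = ⋃ⱼ 𝒯ⱼ ∪ 𝒰` and the
reduction of `∫_{T₀}^{T} |F(1+it)|² dt` by Lemma 12

Topic `NumberTheory/Sieve`; first file of the assembly of `MatomakiRadziwill2016_prop1`
(`MatomakiRadziwill.lean`; Proposition 1 of Matomäki–Radziwiłł, Ann. of Math. 183 (2016), §8) from
its inputs (Lemmas 3, 6, 8, 9, 11, 12, 13; see `MatomakiRadziwillProp1Inputs.lean`,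
`MatomakiRadziwillLemma12.lean`).  Everything here is proved; the new `def`s are the quantities that
§8 introduces at the start of the proof, attached to the interval system `I : SieveIntervalSystem η X`
of §2 (dot notation):

* `I.Hpar j = H_j := j² P₁^{1/6-η} / (log Q₁)^{1/3}`, `SieveIntervalSystem.alpha η j = α_j := 1/4 - η(1 + 1/(2j))`
  ((20)), `I.blocks j = ℐ_j := {v : ⌊H_j log P_j⌋ ≤ v ≤ H_j log Q_j}` (natural `v`);
* `I.goodSet c j` — the `t` with `|Q_{v,H_j}(1+it)| ≤ e^{-α_j v/H_j}` for all `v ∈ ℐ_j` ((21); the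
  prime-block polynomial is `blockPrimePoly c P_j Q_j H_j v`, `c_p = f(p)`);
* `I.Tset c T₀ T j = 𝒯_j` ("`t ∈ 𝒯_j` when `j` is the smallest index such that (21) holds") and
  `I.Uset c T₀ T = 𝒰` ("`t ∈ 𝒰` if this does not hold for any `j`"), as subsets of `[T₀, T]`;
* `I.MemExcept j = 𝒮_j` ("integers which have at least one prime factor in every interval `[P_i, Q_i]`
  with `i ≠ j` and `i ≤ J`"), `I.aCoef f = f 1_𝒮`, `I.bCoef f j = f 1_{𝒮_j}` (the sequences `a_m`,
  `b_m` fed to Lemma 12; `c_p = f(p)`).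

## Results

* `isClosed_goodSet`, `measurableSet_Tset`, `measurableSet_Uset`, `disjoint_Tset`,
  `disjoint_Tset_Uset`, `Icc_eq_biUnion_Tset_union_Uset` — `[T₀, T] = ⋃_{j ≤ J} 𝒯_j ∪ 𝒰` is a
  measurable partition; `integral_Icc_eq_sum_add` splits `∫_{[T₀,T]}` accordingly.
* `Q_lt_P_of_lt`, `not_mem_two_intervals`, `mem_mul_prime_iff` — the intervals are pairwise disjoint,
  so for a prime `p ∈ [P_j, Q_j]` with `p ∤ m`: `mp ∈ 𝒮 ↔ m ∈ 𝒮_j`; hence the factorisation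
  hypothesis of Lemma 12, `aCoef_mul_prime` (`a_{mp} = b_m c_p`), and `coprime_sum_eq_zero` (every
  `n ∈ 𝒮` has a prime factor in `[P_j, Q_j]`, so Lemma 12's coprime term vanishes).
* `integral_Tset_le` — Lemma 12 (`MatomakiRadziwillLemma12.lemma12_bound`, `C₁₂ = 20000`) on `𝒯_j`:
  `∫_{𝒯_j} |F|² ≤ C₁₂ (H_j log(Q_j/P_j) ∑_{v∈ℐ_j} ∫_{𝒯_j} |Q_{v,H_j} R_{v,H_j}|² + (T+X)/X (1/H_j + 1/P_j))`;
  `integral_le_sum_Tset_add_Uset` — the reduction (23) of §8,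
  `∫_{T₀}^{T} |F|² ≤ ∑_{j ≤ J} C₁₂(…) + ∫_𝒰 |F|²`, for `X, T ≥ 1`, `0 ≤ T₀ ≤ T`, `H_j ≥ 1`.
* `one_lt_log_P_one`, `one_lt_log_Q_one`, `Hpar_eq`, `Hpar_one_pos`, `Hpar_one_le`, `one_div_Hpar_one` —
  conditions (2), (3) force `P₁, Q₁ > e`; `H_j = j² H₁ > 0`, `1/H₁ = (log Q₁)^{1/3}/P₁^{1/6-η}`.
* `integral_trivial_le` — the trivial bound `∫_{T₀}^{T} |F|² ≤ 10 T/X + 72` (Lemma 6), which settles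
  Proposition 1 when `T > X` or `H₁ ≤ 2` (later files).

What remains for Proposition 1 (later files): the bounds for `E_1` (§8.1), `E_j`, `j ≥ 2` (§8.2, Lemma 13
and conditions (2), (3)), `∫_𝒰 |F|²` (§8.3: Lemmas 3, 5, 8, 9, 11, a second application of Lemma 12,
Brun–Titchmarsh and an upper-bound sieve) and the conclusion §8.4.

## References

* K. Matomäki, M. Radziwiłł, *Multiplicative functions in short intervals*, Ann. of Math. (2) 183
  (2016), 1015–1056, doi:10.4007/annals.2016.183.3.6, arXiv:1501.04585: §8 up to display (23)
  (arXiv p. 16), §2 (conditions (2), (3)).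
-/

noncomputable section

open Finset Complex MeasureTheory

namespace Literature.NumberTheory.Sieve

namespace SieveIntervalSystem

variable {η X : ℝ} (I : SieveIntervalSystem η X)

/-! ### The parameters `H_j`, `α_j` and the blocks `ℐ_j` of §8 -/

/-- `H_j := j² P₁^{1/6-η} / (log Q₁)^{1/3}` (§8, display before (21)). [cite: MatomakiRadziwillAnnals2016, §8] -/
def Hpar (j : ℕ) : ℝ :=
  (j : ℝ) ^ 2 * I.P 1 ^ (1 / 6 - η) / Real.log (I.Q 1) ^ (1 / 3 : ℝ)

/-- `α_j := 1/4 - η (1 + 1/(2j))` ((20) of §8). [cite: MatomakiRadziwillAnnals2016, §8 (20)] -/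
def alpha (η : ℝ) (j : ℕ) : ℝ :=
  1 / 4 - η * (1 + 1 / (2 * (j : ℝ)))

/-- The block indices `ℐ_j := {v : ⌊H_j log P_j⌋ ≤ v ≤ H_j log Q_j}` (§8). [cite: MatomakiRadziwillAnnals2016, §8] -/
def blocks (j : ℕ) : Finset ℕ :=
  Icc ⌊I.Hpar j * Real.log (I.P j)⌋₊ ⌊I.Hpar j * Real.log (I.Q j)⌋₊

/-- The set of `t` that are **good at level `j`**: `|Q_{v,H_j}(1+it)| ≤ e^{-α_j v/H_j}` for every
`v ∈ ℐ_j`, where `Q_{v,H_j}(1+it) = blockPrimePoly c (P_j) (Q_j) (H_j) v t` is the prime-block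
polynomial with coefficients `c_p` ((21) of §8, with `c_p = f(p)`). [cite: MatomakiRadziwillAnnals2016, §8 (21)] -/
def goodSet (c : ℕ → ℂ) (j : ℕ) : Set ℝ :=
  ⋂ v ∈ I.blocks j, {t : ℝ | ‖blockPrimePoly c (I.P j) (I.Q j) (I.Hpar j) v t‖ ≤
    Real.exp (-(alpha η j * v / I.Hpar j))}

/-- `𝒯_j := {t ∈ [T₀, T] : j is the smallest index (in `[1, J]`) at which `t` is good}` (§8:
"`t ∈ 𝒯_j` when `j` is the smallest index such that (21) holds"). [cite: MatomakiRadziwillAnnals2016, §8] -/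
def Tset (c : ℕ → ℂ) (T₀ T : ℝ) (j : ℕ) : Set ℝ :=
  Set.Icc T₀ T ∩ I.goodSet c j ∩ ⋂ i ∈ Ico 1 j, (I.goodSet c i)ᶜ

/-- `𝒰 := {t ∈ [T₀, T] : t is good at no level j ≤ J}` (§8: "`t ∈ 𝒰` if this does not hold for any
`j`"). [cite: MatomakiRadziwillAnnals2016, §8] -/
def Uset (c : ℕ → ℂ) (T₀ T : ℝ) : Set ℝ :=
  Set.Icc T₀ T ∩ ⋂ j ∈ Icc 1 I.J, (I.goodSet c j)ᶜ

/-- `m ∈ 𝒮_j`: `m` has a prime factor in every `[P_i, Q_i]`, `i ≤ J`, `i ≠ j` (§8: "`𝒮_j` is the set of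
those integers which have at least one prime factor in every interval `[P_i, Q_i]` with `i ≠ j` and
`i ≤ J`"). [cite: MatomakiRadziwillAnnals2016, §8] -/
def MemExcept (j : ℕ) (m : ℕ) : Prop :=
  ∀ i ∈ (Icc 1 I.J).erase j, ∃ p ∈ m.primeFactors, I.P i ≤ (p : ℝ) ∧ (p : ℝ) ≤ I.Q i

/-- `MemExcept j` is decidable (classically). [folklore] -/
noncomputable instance (j : ℕ) : DecidablePred (I.MemExcept j) := fun m => by
  unfold MemExcept; infer_instance

/-! ### Measurability and the partition -/

/-- `goodSet` is closed (finite intersection of closed sublevel sets of continuous functions). [folklore] -/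
theorem isClosed_goodSet (c : ℕ → ℂ) (j : ℕ) : IsClosed (I.goodSet c j) := by
  unfold goodSet
  refine isClosed_biInter fun v _ => ?_
  refine isClosed_le ?_ continuous_const
  have : Continuous fun t : ℝ => blockPrimePoly c (I.P j) (I.Q j) (I.Hpar j) v t := by
    unfold blockPrimePoly
    exact MatomakiRadziwillLemma12.continuous_dsum _ _
  exact this.norm

/-- `𝒯_j` is measurable. [folklore] -/
theorem measurableSet_Tset (c : ℕ → ℂ) (T₀ T : ℝ) (j : ℕ) : MeasurableSet (I.Tset c T₀ T j) := by
  unfold Tset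
  refine (measurableSet_Icc.inter (I.isClosed_goodSet c j).measurableSet).inter ?_
  exact MeasurableSet.biInter (Set.to_countable _) fun i _ => (I.isClosed_goodSet c i).measurableSet.compl

/-- `𝒰` is measurable. [folklore] -/
theorem measurableSet_Uset (c : ℕ → ℂ) (T₀ T : ℝ) : MeasurableSet (I.Uset c T₀ T) := by
  unfold Uset
  exact measurableSet_Icc.inter
    (MeasurableSet.biInter (Set.to_countable _) fun j _ => (I.isClosed_goodSet c j).measurableSet.compl)

/-- `𝒯_j ⊆ [T₀, T]`. [folklore] -/
theorem Tset_subset (c : ℕ → ℂ) (T₀ T : ℝ) (j : ℕ) : I.Tset c T₀ T j ⊆ Set.Icc T₀ T :=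
  fun _ ht => ht.1.1

/-- `𝒰 ⊆ [T₀, T]`. [folklore] -/
theorem Uset_subset (c : ℕ → ℂ) (T₀ T : ℝ) : I.Uset c T₀ T ⊆ Set.Icc T₀ T :=
  fun _ ht => ht.1

/-- The `𝒯_j` are pairwise disjoint. [folklore] -/
theorem disjoint_Tset (c : ℕ → ℂ) (T₀ T : ℝ) {i j : ℕ} (hi : 1 ≤ i) (hij : i ≠ j) (hj : 1 ≤ j) :
    Disjoint (I.Tset c T₀ T i) (I.Tset c T₀ T j) := by
  rw [Set.disjoint_left]
  intro t hti htj
  rcases lt_or_gt_of_ne hij with h | h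
  · -- `t` is good at level `i < j`, contradicting `t ∈ 𝒯_j`
    have h1 : t ∈ I.goodSet c i := hti.1.2
    have h2 := htj.2
    simp only [Set.mem_iInter, Set.mem_compl_iff] at h2
    exact h2 i (mem_Ico.2 ⟨hi, h⟩) h1
  · have h1 : t ∈ I.goodSet c j := htj.1.2
    have h2 := hti.2
    simp only [Set.mem_iInter, Set.mem_compl_iff] at h2
    exact h2 j (mem_Ico.2 ⟨hj, h⟩) h1

/-- `𝒯_j` and `𝒰` are disjoint for `j ∈ [1, J]`. [folklore] -/
theorem disjoint_Tset_Uset (c : ℕ → ℂ) (T₀ T : ℝ) {j : ℕ} (hj : j ∈ Icc 1 I.J) :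
    Disjoint (I.Tset c T₀ T j) (I.Uset c T₀ T) := by
  rw [Set.disjoint_left]
  intro t htj htU
  have h2 := htU.2
  simp only [Set.mem_iInter, Set.mem_compl_iff] at h2
  exact h2 j hj htj.1.2

/-- **The partition** `[T₀, T] = ⋃_{j=1}^{J} 𝒯_j ∪ 𝒰` (§8). [cite: MatomakiRadziwillAnnals2016, §8] -/
theorem Icc_eq_biUnion_Tset_union_Uset (c : ℕ → ℂ) (T₀ T : ℝ) :
    Set.Icc T₀ T = (⋃ j ∈ Icc 1 I.J, I.Tset c T₀ T j) ∪ I.Uset c T₀ T := by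
  classical
  ext t
  simp only [Set.mem_union, Set.mem_iUnion, exists_prop]
  constructor
  · intro ht
    by_cases h : ∃ j ∈ Icc 1 I.J, t ∈ I.goodSet c j
    · left
      -- the smallest good level
      set s := (Icc 1 I.J).filter (fun j => t ∈ I.goodSet c j) with hs
      have hne : s.Nonempty := by
        obtain ⟨j, hj, hjt⟩ := h
        exact ⟨j, mem_filter.2 ⟨hj, hjt⟩⟩
      refine ⟨s.min' hne, (mem_filter.1 (s.min'_mem hne)).1, ?_⟩
      refine ⟨⟨ht, (mem_filter.1 (s.min'_mem hne)).2⟩, ?_⟩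
      simp only [Set.mem_iInter, Set.mem_compl_iff]
      intro i hi hit
      rw [mem_Ico] at hi
      have hiJ : i ∈ Icc 1 I.J := by
        have := (mem_Icc.1 (mem_filter.1 (s.min'_mem hne)).1).2
        exact mem_Icc.2 ⟨hi.1, by omega⟩
      have : s.min' hne ≤ i := s.min'_le i (mem_filter.2 ⟨hiJ, hit⟩)
      omega
    · right
      refine ⟨ht, ?_⟩
      simp only [Set.mem_iInter, Set.mem_compl_iff]
      intro j hj hjt
      exact h ⟨j, hj, hjt⟩
  · rintro (⟨j, _, ht⟩ | ht)
    · exact ht.1.1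
    · exact ht.1

/-- Splitting an integral over `[T₀, T]` along the partition. [folklore] -/
theorem integral_Icc_eq_sum_add (c : ℕ → ℂ) (T₀ T : ℝ) {g : ℝ → ℝ}
    (hg : IntegrableOn g (Set.Icc T₀ T)) :
    ∫ t in Set.Icc T₀ T, g t =
      (∑ j ∈ Icc 1 I.J, ∫ t in I.Tset c T₀ T j, g t) + ∫ t in I.Uset c T₀ T, g t := by
  have hU := I.Icc_eq_biUnion_Tset_union_Uset c T₀ T
  have hdisj : Disjoint (⋃ j ∈ Icc 1 I.J, I.Tset c T₀ T j) (I.Uset c T₀ T) := by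
    rw [Set.disjoint_iUnion₂_left]
    intro j hj
    exact I.disjoint_Tset_Uset c T₀ T hj
  have hsubB : (⋃ j ∈ Icc 1 I.J, I.Tset c T₀ T j) ⊆ Set.Icc T₀ T := by
    rw [Set.iUnion₂_subset_iff]
    intro j _
    exact I.Tset_subset c T₀ T j
  conv_lhs => rw [hU]
  rw [setIntegral_union hdisj (I.measurableSet_Uset c T₀ T) (hg.mono_set hsubB)
    (hg.mono_set (I.Uset_subset c T₀ T))]
  congr 1
  refine integral_biUnion_finset _ (fun j _ => I.measurableSet_Tset c T₀ T j) ?_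
    (fun j _ => hg.mono_set (I.Tset_subset c T₀ T j))
  intro i hi j hj hij
  exact I.disjoint_Tset c T₀ T (mem_Icc.1 hi).1 hij (mem_Icc.1 hj).1

/-! ### Disjointness of the intervals and the factorisation `a_{mp} = b_m c_p` -/

/-- `Q_i < P_j` for `1 ≤ i < j`: the intervals `[P_j, Q_j]` are pairwise disjoint and increase.
[cite: MatomakiRadziwillAnnals2016, §2] -/
theorem Q_lt_P_of_lt (hη : 0 < η) (hη' : η ≤ 8) {i j : ℕ} (hi : 1 ≤ i) (hij : i < j) :
    I.Q i < I.P j := by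
  induction j, hij using Nat.le_induction with
  | base => exact I.Q_lt_P_succ hη hη' hi
  | succ j hj ih =>
    exact (ih.trans_le (I.P_le_Q j (by omega))).trans (I.Q_lt_P_succ hη hη' (by omega))

/-- `1 ≤ P_j` for all `j ≥ 1`. [folklore] -/
theorem one_le_P (hη : 0 < η) (hη' : η ≤ 8) {j : ℕ} (hj : 1 ≤ j) : 1 ≤ I.P j := by
  rcases eq_or_lt_of_le hj with h | h
  · rw [← h]; exact I.one_le_P_one
  · exact ((I.one_le_Q hη hη' le_rfl).trans (I.Q_lt_P_of_lt hη hη' le_rfl h).le)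

/-- No real number lies in two different intervals `[P_i, Q_i]`, `[P_j, Q_j]` (`i ≠ j`, both `≥ 1`).
[folklore] -/
theorem not_mem_two_intervals (hη : 0 < η) (hη' : η ≤ 8) {i j : ℕ} (hi : 1 ≤ i) (hj : 1 ≤ j)
    (hij : i ≠ j) {x : ℝ} (hxi : I.P i ≤ x ∧ x ≤ I.Q i) (hxj : I.P j ≤ x ∧ x ≤ I.Q j) : False := by
  rcases lt_or_gt_of_ne hij with h | h
  · have := I.Q_lt_P_of_lt hη hη' hi h
    linarith [hxi.2, hxj.1]
  · have := I.Q_lt_P_of_lt hη hη' hj h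
    linarith [hxj.2, hxi.1]

/-- **`𝒮` versus `𝒮_j`**: for a prime `p ∈ [P_j, Q_j]` (`1 ≤ j ≤ J`) not dividing `m ≠ 0`,
`mp ∈ 𝒮 ↔ m ∈ 𝒮_j` (the prime factors of `mp` are those of `m` and `p`, and `p` lies in no other
interval). [cite: MatomakiRadziwillAnnals2016, §8] -/
theorem mem_mul_prime_iff (hη : 0 < η) (hη' : η ≤ 8) {j : ℕ} (hj : j ∈ Icc 1 I.J) {m p : ℕ}
    (hm : m ≠ 0) (hp : p.Prime) (hPp : I.P j ≤ p) (hpQ : (p : ℝ) ≤ I.Q j) :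
    I.Mem (m * p) ↔ I.MemExcept j m := by
  have hpf : (m * p).primeFactors = m.primeFactors ∪ {p} := by
    rw [Nat.primeFactors_mul hm hp.ne_zero, hp.primeFactors]
  have hj1 : 1 ≤ j := (mem_Icc.1 hj).1
  constructor
  · intro h i hi
    rw [mem_erase] at hi
    obtain ⟨q, hq, hqi⟩ := h i hi.2
    rw [hpf, mem_union, mem_singleton] at hq
    rcases hq with hq | rfl
    · exact ⟨q, hq, hqi⟩
    · exact (I.not_mem_two_intervals hη hη' (mem_Icc.1 hi.2).1 hj1 hi.1 hqi ⟨hPp, hpQ⟩).elim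
  · intro h i hi
    by_cases hij : i = j
    · subst hij
      refine ⟨p, ?_, hPp, hpQ⟩
      rw [hpf, mem_union, mem_singleton]
      exact Or.inr rfl
    · obtain ⟨q, hq, hqi⟩ := h i (mem_erase.2 ⟨hij, hi⟩)
      refine ⟨q, ?_, hqi⟩
      rw [hpf, mem_union]
      exact Or.inl hq

/-- The coefficients `a_n = f(n) 1_𝒮(n)` of §8. [cite: MatomakiRadziwillAnnals2016, §8] -/
def aCoef (f : ℕ → ℝ) : ℕ → ℂ := fun n => if I.Mem n then (f n : ℂ) else 0

/-- The coefficients `b_m = f(m) 1_{𝒮_j}(m)` of §8. [cite: MatomakiRadziwillAnnals2016, §8] -/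
def bCoef (f : ℕ → ℝ) (j : ℕ) : ℕ → ℂ := fun m => if I.MemExcept j m then (f m : ℂ) else 0

/-- `|a_n| ≤ 1`. [folklore] -/
theorem norm_aCoef_le {f : ℕ → ℝ} (hf1 : ∀ n, |f n| ≤ 1) (n : ℕ) : ‖I.aCoef f n‖ ≤ 1 := by
  unfold aCoef
  split_ifs
  · rw [Complex.norm_real, Real.norm_eq_abs]; exact hf1 n
  · simp

/-- `|b_m| ≤ 1`. [folklore] -/
theorem norm_bCoef_le {f : ℕ → ℝ} (hf1 : ∀ n, |f n| ≤ 1) (j m : ℕ) : ‖I.bCoef f j m‖ ≤ 1 := by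
  unfold bCoef
  split_ifs
  · rw [Complex.norm_real, Real.norm_eq_abs]; exact hf1 m
  · simp

/-- `|c_p| = |f(p)| ≤ 1`. [folklore] -/
theorem norm_cCoef_le {f : ℕ → ℝ} (hf1 : ∀ n, |f n| ≤ 1) (p : ℕ) : ‖((f p : ℝ) : ℂ)‖ ≤ 1 := by
  rw [Complex.norm_real, Real.norm_eq_abs]; exact hf1 p

/-- **The factorisation hypothesis of Lemma 12**: `a_{mp} = b_m c_p` for `p ∈ [P_j, Q_j]` prime,
`p ∤ m`, with `a = f 1_𝒮`, `b = f 1_{𝒮_j}`, `c = f` (`f` multiplicative). [cite: MatomakiRadziwillAnnals2016, §8] -/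
theorem aCoef_mul_prime (hη : 0 < η) (hη' : η ≤ 8) {f : ArithmeticFunction ℝ}
    (hf : f.IsMultiplicative) {j : ℕ} (hj : j ∈ Icc 1 I.J) :
    ∀ m p : ℕ, p.Prime → I.P j ≤ p → (p : ℝ) ≤ I.Q j → ¬ p ∣ m →
      I.aCoef f (m * p) = I.bCoef f j m * ((f p : ℝ) : ℂ) := by
  intro m p hp hPp hpQ hpm
  have hm : m ≠ 0 := by rintro rfl; exact hpm (dvd_zero p)
  have hcop : Nat.Coprime m p := (Nat.Prime.coprime_iff_not_dvd hp).2 hpm |>.symm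
  unfold aCoef bCoef
  rw [hf.map_mul_of_coprime hcop]
  by_cases h : I.MemExcept j m
  · rw [if_pos ((I.mem_mul_prime_iff hη hη' hj hm hp hPp hpQ).2 h), if_pos h]
    push_cast
    ring
  · rw [if_neg (fun h' => h ((I.mem_mul_prime_iff hη hη' hj hm hp hPp hpQ).1 h')), if_neg h,
      zero_mul]

/-- The Dirichlet polynomial of `a = f 1_𝒮` over `[X, 2X]` is `F(1+it) = ∑_{X ≤ n ≤ 2X, n ∈ 𝒮} f(n) n^{-1-it}`.
[folklore] -/
theorem sum_aCoef_eq (f : ℕ → ℝ) (t : ℝ) :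
    ∑ n ∈ Icc ⌈X⌉₊ ⌊2 * X⌋₊, I.aCoef f n * (n : ℂ) ^ (-(1 + (t : ℂ) * Complex.I)) =
      ∑ n ∈ (Icc ⌈X⌉₊ ⌊2 * X⌋₊).filter I.Mem,
        (f n : ℂ) * (n : ℂ) ^ (-(1 + (t : ℂ) * Complex.I)) := by
  rw [sum_filter]
  refine sum_congr rfl fun n _ => ?_
  unfold aCoef
  split_ifs <;> simp

/-- For `a = f 1_𝒮` and `1 ≤ j ≤ J` the "coprime" term of Lemma 12 vanishes: every `n ∈ 𝒮` has a prime
factor in `[P_j, Q_j]`. [cite: MatomakiRadziwillAnnals2016, §8] -/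
theorem coprime_sum_eq_zero (f : ℕ → ℝ) {j : ℕ} (hj : j ∈ Icc 1 I.J) :
    ∑ n ∈ (Icc ⌈X⌉₊ ⌊2 * X⌋₊).filter
        (fun n : ℕ => ∀ p ∈ (Icc ⌈I.P j⌉₊ ⌊I.Q j⌋₊).filter Nat.Prime, ¬ p ∣ n),
      ‖I.aCoef f n‖ ^ 2 / n = 0 := by
  refine sum_eq_zero fun n hn => ?_
  rw [mem_filter] at hn
  have : I.aCoef f n = 0 := by
    unfold aCoef
    rw [if_neg]
    intro hmem
    obtain ⟨p, hp, hPp, hpQ⟩ := hmem j hj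
    have hpP : p ∈ (Icc ⌈I.P j⌉₊ ⌊I.Q j⌋₊).filter Nat.Prime := by
      rw [mem_filter, mem_Icc]
      exact ⟨⟨Nat.ceil_le.2 hPp, Nat.le_floor hpQ⟩, Nat.prime_of_mem_primeFactors hp⟩
    exact hn.2 p hpP (Nat.dvd_of_mem_primeFactors hp)
  rw [this, norm_zero]
  simp

/-! ### The reduction by Lemma 12 on each `𝒯_j` -/

/-- **Lemma 12 on `𝒯_j`** (§8, the display after "we see that"): for `1 ≤ j ≤ J` with `H_j ≥ 1`,
`X, T ≥ 1`, `0 ≤ T₀`,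
`∫_{𝒯_j} |F(1+it)|² dt ≤ C₁₂ (H_j log(Q_j/P_j) ∑_{v ∈ ℐ_j} ∫_{𝒯_j} |Q_{v,H_j} R_{v,H_j}|² dt + (T+X)/X (1/H_j + 1/P_j))`
with `C₁₂ = 20000`, `Q_{v,H_j} = blockPrimePoly f P_j Q_j H_j v`, `R_{v,H_j} = blockCofactorPoly (f 1_{𝒮_j}) X P_j Q_j H_j v`
(the coprime term of Lemma 12 vanishes by `coprime_sum_eq_zero`). [cite: MatomakiRadziwillAnnals2016, §8] -/
theorem integral_Tset_le (hη : 0 < η) (hη' : η ≤ 8) (f : ArithmeticFunction ℝ)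
    (hf : f.IsMultiplicative) (hf1 : ∀ n, |f n| ≤ 1) (hX : 1 ≤ X) {T₀ T : ℝ} (hT₀ : 0 ≤ T₀)
    (hT : 1 ≤ T) {j : ℕ} (hj : j ∈ Icc 1 I.J) (hH : 1 ≤ I.Hpar j) :
    ∫ t in I.Tset (fun p => ((f p : ℝ) : ℂ)) T₀ T j,
        ‖∑ n ∈ (Icc ⌈X⌉₊ ⌊2 * X⌋₊).filter I.Mem,
            (f n : ℂ) * (n : ℂ) ^ (-(1 + (t : ℂ) * Complex.I))‖ ^ 2 ≤
      20000 * ((I.Hpar j * Real.log (I.Q j / I.P j)) *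
          (∑ v ∈ I.blocks j, ∫ t in I.Tset (fun p => ((f p : ℝ) : ℂ)) T₀ T j,
            ‖blockPrimePoly (fun p => ((f p : ℝ) : ℂ)) (I.P j) (I.Q j) (I.Hpar j) v t *
              blockCofactorPoly (I.bCoef f j) X (I.P j) (I.Q j) (I.Hpar j) v t‖ ^ 2)
        + (T + X) / X * (1 / I.Hpar j + 1 / I.P j)) := by
  have hj1 : 1 ≤ j := (mem_Icc.1 hj).1
  have hsub : I.Tset (fun p => ((f p : ℝ) : ℂ)) T₀ T j ⊆ Set.Icc (-T) T :=
    (I.Tset_subset _ T₀ T j).trans (Set.Icc_subset_Icc (by linarith) le_rfl)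
  have h := MatomakiRadziwillLemma12.lemma12_bound X T (I.P j) (I.Q j) (I.Hpar j) (I.aCoef f)
    (I.bCoef f j) (fun p => ((f p : ℝ) : ℂ)) (I.Tset (fun p => ((f p : ℝ) : ℂ)) T₀ T j) hX hT
    (I.one_le_P hη hη' hj1) (I.P_le_Q j hj1) hH (I.norm_aCoef_le hf1) (I.norm_bCoef_le hf1 j)
    (norm_cCoef_le hf1) (I.aCoef_mul_prime hη hη' hf hj) hsub
  simp only [I.sum_aCoef_eq] at h
  rw [I.coprime_sum_eq_zero f hj, add_zero] at h
  unfold blocks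
  exact h

/-- **The reduction (23) of §8**: for `X, T ≥ 1`, `0 ≤ T₀ ≤ T` and `H_j ≥ 1` (`1 ≤ j ≤ J`),
`∫_{T₀}^{T} |F(1+it)|² dt ≤ ∑_{j=1}^{J} C₁₂ (H_j log(Q_j/P_j) ∑_{v∈ℐ_j} ∫_{𝒯_j} |Q_{v,H_j} R_{v,H_j}|² dt
 + (T+X)/X (1/H_j + 1/P_j)) + ∫_𝒰 |F(1+it)|² dt`. [cite: MatomakiRadziwillAnnals2016, §8 (23)] -/
theorem integral_le_sum_Tset_add_Uset (hη : 0 < η) (hη' : η ≤ 8) (f : ArithmeticFunction ℝ)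
    (hf : f.IsMultiplicative) (hf1 : ∀ n, |f n| ≤ 1) (hX : 1 ≤ X) {T₀ T : ℝ} (hT₀ : 0 ≤ T₀)
    (hT₀T : T₀ ≤ T) (hT : 1 ≤ T) (hH : ∀ j ∈ Icc 1 I.J, 1 ≤ I.Hpar j) :
    ∫ t in T₀..T, ‖∑ n ∈ (Icc ⌈X⌉₊ ⌊2 * X⌋₊).filter I.Mem,
        (f n : ℂ) * (n : ℂ) ^ (-(1 + (t : ℂ) * Complex.I))‖ ^ 2 ≤
      (∑ j ∈ Icc 1 I.J, 20000 * ((I.Hpar j * Real.log (I.Q j / I.P j)) *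
          (∑ v ∈ I.blocks j, ∫ t in I.Tset (fun p => ((f p : ℝ) : ℂ)) T₀ T j,
            ‖blockPrimePoly (fun p => ((f p : ℝ) : ℂ)) (I.P j) (I.Q j) (I.Hpar j) v t *
              blockCofactorPoly (I.bCoef f j) X (I.P j) (I.Q j) (I.Hpar j) v t‖ ^ 2)
        + (T + X) / X * (1 / I.Hpar j + 1 / I.P j)))
      + ∫ t in I.Uset (fun p => ((f p : ℝ) : ℂ)) T₀ T,
          ‖∑ n ∈ (Icc ⌈X⌉₊ ⌊2 * X⌋₊).filter I.Mem,
            (f n : ℂ) * (n : ℂ) ^ (-(1 + (t : ℂ) * Complex.I))‖ ^ 2 := by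
  have hcont : Continuous fun t : ℝ => ‖∑ n ∈ (Icc ⌈X⌉₊ ⌊2 * X⌋₊).filter I.Mem,
      (f n : ℂ) * (n : ℂ) ^ (-(1 + (t : ℂ) * Complex.I))‖ ^ 2 :=
    ((MatomakiRadziwillLemma12.continuous_dsum _ _).norm).pow 2
  rw [intervalIntegral.integral_of_le hT₀T, ← integral_Icc_eq_integral_Ioc,
    I.integral_Icc_eq_sum_add (fun p => ((f p : ℝ) : ℂ)) T₀ T hcont.integrableOn_Icc]
  gcongr with j hj
  exact I.integral_Tset_le hη hη' f hf hf1 hX hT₀ hT hj (hH j hj)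

/-! ### Size of the parameters -/

/-- `log P₁ > 1` (hence `P₁ > e`): condition (3) at `j = 2` gives `log P₂ ≥ 64 log 2 / η > 1`, and then
condition (2) at `j = 2`, `0 < log log Q₂ ≤ (η/16)(log P₁ - 1)`, forces `log P₁ > 1`. [folklore] -/
theorem one_lt_log_P_one (hη : 0 < η) (hη' : η ≤ 8) : 1 < Real.log (I.P 1) := by
  have h3 := I.notTooClose 2 le_rfl
  have h2 := I.notTooFar 2 le_rfl
  norm_num at h3 h2
  have hQ1 : 0 ≤ Real.log (I.Q 1) := Real.log_nonneg (I.one_le_Q hη hη' le_rfl)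
  have hlog2 : (0.69 : ℝ) < Real.log 2 := by
    have := Real.log_two_gt_d9; linarith
  -- `log P₂ > 1`
  have hP2 : 1 < Real.log (I.P 2) := by
    by_contra hle
    push Not at hle
    have : η / 4 * Real.log (I.P 2) ≤ 8 / 4 * 1 := by
      rcases le_or_gt 0 (Real.log (I.P 2)) with h0 | h0
      · exact mul_le_mul (by linarith) hle h0 (by norm_num)
      · have : η / 4 * Real.log (I.P 2) ≤ 0 := mul_nonpos_of_nonneg_of_nonpos (by positivity) h0.le
        linarith
    linarith
  have hQ2 : 1 < Real.log (I.Q 2) :=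
    hP2.trans_le (Real.log_le_log (I.pos_P 2 (by norm_num)) (I.P_le_Q 2 (by norm_num)))
  have hllQ2 : 0 < Real.log (Real.log (I.Q 2)) := Real.log_pos hQ2
  -- (2): `log log Q₂ ≤ η/16 (log P₁ - 1)`
  by_contra hle
  push Not at hle
  have : η / (4 * 2 ^ 2) * (Real.log (I.P 1) - 1) ≤ 0 :=
    mul_nonpos_of_nonneg_of_nonpos (by positivity) (by linarith)
  linarith

/-- `log Q₁ > 1`. [folklore] -/
theorem one_lt_log_Q_one (hη : 0 < η) (hη' : η ≤ 8) : 1 < Real.log (I.Q 1) :=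
  (I.one_lt_log_P_one hη hη').trans_le
    (Real.log_le_log (I.pos_P 1 le_rfl) (I.P_le_Q 1 le_rfl))

/-- `H_j = j² H₁`. [folklore] -/
theorem Hpar_eq (j : ℕ) : I.Hpar j = (j : ℝ) ^ 2 * I.Hpar 1 := by
  unfold Hpar; simp; ring

/-- `H₁ = P₁^{1/6-η}/(log Q₁)^{1/3} > 0`. [folklore] -/
theorem Hpar_one_pos (hη : 0 < η) (hη' : η ≤ 8) : 0 < I.Hpar 1 := by
  unfold Hpar
  have h1 : 0 < I.P 1 := I.pos_P 1 le_rfl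
  have h2 : 0 < Real.log (I.Q 1) := by linarith [I.one_lt_log_Q_one hη hη']
  simp only [Nat.cast_one, one_pow, one_mul]
  positivity

/-- `H_j ≥ H₁` for `j ≥ 1`, so `H₁ ≥ 1` implies `H_j ≥ 1`. [folklore] -/
theorem Hpar_one_le (hη : 0 < η) (hη' : η ≤ 8) {j : ℕ} (hj : 1 ≤ j) : I.Hpar 1 ≤ I.Hpar j := by
  rw [I.Hpar_eq j]
  have h1 : (1 : ℝ) ≤ (j : ℝ) ^ 2 := by
    have : (1 : ℝ) ≤ j := by exact_mod_cast hj
    nlinarith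
  exact le_mul_of_one_le_left (I.Hpar_one_pos hη hη').le h1

/-- `1/H₁ = (log Q₁)^{1/3} / P₁^{1/6-η}`, the first error term of Proposition 1. [folklore] -/
theorem one_div_Hpar_one : 1 / I.Hpar 1 = Real.log (I.Q 1) ^ (1 / 3 : ℝ) / I.P 1 ^ (1 / 6 - η) := by
  unfold Hpar; simp

/-! ### The trivial bound (Lemma 6) -/

/-- **The trivial bound** (§8, Remark after Proposition 1: "the 'trivial bound' for `∫_0^T |F(1+it)|² dt`,
obtained by applying a standard mean-value theorem (Lemma 6), is `T/X + 1`"), in the explicit form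
`∫_{T₀}^{T} |F(1+it)|² dt ≤ 10 T/X + 72` for `X ≥ 1`, `0 ≤ T₀ ≤ T`, `0 < T`. [cite: MatomakiRadziwillAnnals2016, §8 (Remark)] -/
theorem integral_trivial_le (f : ℕ → ℝ) (hf1 : ∀ n, |f n| ≤ 1) (hX : 1 ≤ X) {T₀ T : ℝ}
    (hT₀ : 0 ≤ T₀) (hT₀T : T₀ ≤ T) (hT : 0 < T) :
    ∫ t in T₀..T, ‖∑ n ∈ (Icc ⌈X⌉₊ ⌊2 * X⌋₊).filter I.Mem,
        (f n : ℂ) * (n : ℂ) ^ (-(1 + (t : ℂ) * Complex.I))‖ ^ 2 ≤ 10 * T / X + 72 := by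
  have hX0 : 0 < X := by linarith
  have hsub : (Icc ⌈X⌉₊ ⌊2 * X⌋₊).filter I.Mem ⊆ Icc 1 ⌊2 * X⌋₊ :=
    (filter_subset _ _).trans (MatomakiRadziwillLemma12.Nn_subset hX0)
  have hIcc : Set.Icc T₀ T ⊆ Set.Icc (-T) T := Set.Icc_subset_Icc (by linarith) le_rfl
  have h := MatomakiRadziwillLemma12.meanvalue_subset ((Icc ⌈X⌉₊ ⌊2 * X⌋₊).filter I.Mem) ⌊2 * X⌋₊
    hsub (fun n => (f n : ℂ)) hT hIcc
  rw [intervalIntegral.integral_of_le hT₀T, ← integral_Icc_eq_integral_Ioc]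
  refine h.trans ?_
  -- `∑_{n} |f n|²/n² ≤ #[X,2X]/X² ≤ 2/X`
  have hM : (⌊2 * X⌋₊ : ℝ) ≤ 2 * X := Nat.floor_le (by positivity)
  have hterm : ∀ n ∈ (Icc ⌈X⌉₊ ⌊2 * X⌋₊).filter I.Mem, ‖(f n : ℂ)‖ ^ 2 / (n : ℝ) ^ 2 ≤ 1 / X ^ 2 := by
    intro n hn
    have hXn : X ≤ n := Nat.ceil_le.1 (mem_Icc.1 (mem_filter.1 hn).1).1
    have h1 : ‖(f n : ℂ)‖ ^ 2 ≤ 1 := by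
      rw [Complex.norm_real, Real.norm_eq_abs]
      have := hf1 n
      have h0 := abs_nonneg (f n)
      nlinarith only [this, h0]
    calc ‖(f n : ℂ)‖ ^ 2 / (n : ℝ) ^ 2 ≤ 1 / (n : ℝ) ^ 2 :=
          div_le_div_of_nonneg_right h1 (by positivity)
      _ ≤ 1 / X ^ 2 := div_le_div_of_nonneg_left zero_le_one (by positivity)
          (pow_le_pow_left₀ hX0.le hXn 2)
  have hcard : (#((Icc ⌈X⌉₊ ⌊2 * X⌋₊).filter I.Mem) : ℝ) ≤ X + 1 := by
    calc (#((Icc ⌈X⌉₊ ⌊2 * X⌋₊).filter I.Mem) : ℝ) ≤ #(Icc ⌈X⌉₊ ⌊2 * X⌋₊) := by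
          exact_mod_cast card_filter_le _ _
      _ = ((⌊2 * X⌋₊ + 1 - ⌈X⌉₊ : ℕ) : ℝ) := by rw [Nat.card_Icc]
      _ ≤ X + 1 := by
          rcases le_or_gt ⌈X⌉₊ (⌊2 * X⌋₊ + 1) with hle | hlt
          · rw [Nat.cast_sub hle]; push_cast; linarith [Nat.le_ceil X]
          · rw [Nat.sub_eq_zero_of_le hlt.le]; push_cast; linarith
  calc (5 * T + 18 * (⌊2 * X⌋₊ : ℝ)) *
        ∑ n ∈ (Icc ⌈X⌉₊ ⌊2 * X⌋₊).filter I.Mem, ‖(f n : ℂ)‖ ^ 2 / (n : ℝ) ^ 2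
      ≤ (5 * T + 36 * X) * ∑ n ∈ (Icc ⌈X⌉₊ ⌊2 * X⌋₊).filter I.Mem, (1 / X ^ 2 : ℝ) :=
        mul_le_mul (by linarith) (sum_le_sum hterm) (sum_nonneg fun n _ => by positivity)
          (by positivity)
    _ = (5 * T + 36 * X) * (#((Icc ⌈X⌉₊ ⌊2 * X⌋₊).filter I.Mem) * (1 / X ^ 2)) := by
        rw [sum_const, nsmul_eq_mul]
    _ ≤ (5 * T + 36 * X) * ((X + 1) * (1 / X ^ 2)) := by gcongr
    _ ≤ (5 * T + 36 * X) * (2 / X) := by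
        refine mul_le_mul_of_nonneg_left ?_ (by positivity)
        rw [show (X + 1) * (1 / X ^ 2) = (X + 1) / X ^ 2 by ring, div_le_div_iff₀ (by positivity) hX0]
        nlinarith
    _ = 10 * T / X + 72 := by field_simp; ring

end SieveIntervalSystem

end Literature.NumberTheory.Sieve
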